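/-
Copyright (c) 2026. All rights reserved.
Released under Apache 2.0 license as described in the file LICENSE.
Authors: abc-iut cell, prover seat abc-iut-w5-d138 (wave 5, gen 8).
-/
import Summits.ABC.IUTFork.Cor312Ind3IteratesVacuityRamificationCriterion
import Literature.IUT.LogThetaLattice.LogLinkIteratesDepthThree
import Literature.IUT.LogVolume.LocalDegreeBridge
import HarnessLib

/-!
# (Ind3) honest iterates at `p_v` odd, `p_v ∣ e(v|p_v)`: DEPTH `3` is NOT decided by `(p_v, e, f)`

Proof-only sequel (theorems, no definitions) of the honest-model census of the [IUTchIII] log-link iterates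
(abc-iut-w4-d029's `Real.nonarchIterImage (analyticLogv F) v m′` over `Cor312Ind3RealIterates`, with
abc-iut-c312-5's ANALYTIC logarithms `Real.analyticLogv`; S. Mochizuki, *Inter-universal Teichmüller theory
III*, kurims manuscript (May 2020), Prop. 3.5 (ii) (a), Rmk. 1.1.1 (i) p. 28 [claim: Mochizuki2012, status:
disputed; cited record-only]).  Census of record so far (abc-iut-w5-d017, p433144): at a finite place `v` with
`p_v` ODD, the depth-`≥ 2` images are EMPTY iff `p_v ∤ e(v|p_v)`, and the depth-`2` image is INHABITED iff
`p_v ∣ e(v|p_v)`.  THIS FILE transports abc-iut-w5-d138's local depth-`3` dichotomy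
(`Literature/IUT/LogVolume/UnitLogDepthThreeDichotomy.lean`, `…/LogThetaLattice/LogLinkIteratesDepthThree.lean`)
to the completions through abc-iut-S7's rescaled completion (`e(F_v) = e(v|p)`, `f(F_v) = f(v|p)`,
`[F_v : ℚ_p] = n_v ≤ [F : ℚ]`):

* `Real.nonarchIterImage_analyticLogv_three_eq_empty_of_pow_eq` — **at a finite place `v` with `p_v` odd,
  `e(v|p_v) = p_v`, `f(v|p_v) = 1` whose completion contains `x` with `x^{p_v} = p_v(1 − x)`, the honest
  depth-`3` (Ind3) image is EMPTY** (no unit survives two log-links), although the depth-`2` image is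
  inhabited (`p_v ∣ e`); hence every depth `≥ 3` is empty there (`…_add_three_eq_empty_of_pow_eq`);
* `Real.nonarchIterImage_analyticLogv_nonempty_of_pow_prime` — **at a finite place over an odd `p` whose
  completion contains a `p`-th root of `p`, EVERY honest (Ind3) image is INHABITED** (all iterates
  `log_v^{[n]}(1 + x)` are units, abc-iut-w5-d138 gen 4) — the all-depth upgrade of abc-iut-w5-d172's
  depth-`2` statement p425849;
* existence for every odd `p`, both at `(p_v, e, f) = (p, p, 1)`:
  `Real.exists_numberField_nonarchIterImage_three_eq_empty` (`F = ℚ[X]/(g)`, `g ∣ Xᵖ + pX − p`) and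
  `Real.exists_numberField_forall_nonarchIterImage_nonempty` (`g ∣ Xᵖ − p`), with `e(v|p) = p`,
  `f(v|p) = 1` COMPUTED (`ramificationIdx_eq_and_inertiaDeg_eq_of_finrank_le`: `[F : ℚ] ≤ p` and an
  element of rescaled norm `p^{−1/p}` in `F_v` force `e = p`, `f = 1`).

So the census sentence for odd `p_v` gains: "the depth-`m′ ≥ 3` clauses at places with `p_v ∣ e(v|p_v)` are
NOT a function of `(p_v, e(v|p_v), f(v|p_v))`".  Honest framing: statements ABOUT THE MODEL (which typed (Ind3)
containments are `∅ ⊆ _`); nothing here asserts or denies [IUTchIII] Cor. 3.12 or takes a side; census ≠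
verdict; typed ≠ proved.  No definitions, no Prop-valued fact (D-0067 (1)).
-/

noncomputable section

open Set

namespace Summit.ABC.IUTFork.Thm311.Real

open NumberField IsDedekindDomain Literature.IUT.LogVolume Literature.IUT.LogThetaLattice
  Literature.NumberTheory.NumberFields Polynomial

variable {F : Type} [Field F] [NumberField F]

/-! ## 1. A depth-`3` element is carried by a chain of three units -/

/-- An element of the honest depth-`3` image at `v` is `log_v u₂` for units `u₀, u₁, u₂ ∈ O_v^×` with
`log_v u₀ = u₁`, `log_v u₁ = u₂` (any family `logv`). [claim: Mochizuki2012, status: disputed] -/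
theorem exists_units_of_mem_nonarchIterImage_three (logv : PadicLogs F) (v : HeightOneSpectrum (𝓞 F))
    {z : Carrier (.inr v : Place F)} (hz : z ∈ nonarchIterImage logv v 3) :
    ∃ u₀ u₁ u₂ : (↥(integers v))ˣ,
      logv v (Additive.ofMul u₀) = ((u₁ : ↥(integers v)) : Carrier (.inr v : Place F)) ∧
        logv v (Additive.ofMul u₁) = ((u₂ : ↥(integers v)) : Carrier (.inr v : Place F)) ∧
          logv v (Additive.ofMul u₂) = z := by
  obtain ⟨u₂, hu₂, rfl⟩ := hz
  obtain ⟨u₁, hu₁, hu₁eq⟩ := hu₂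
  obtain ⟨u₀, -, hu₀eq⟩ := hu₁
  exact ⟨u₀, u₁, u₂, hu₀eq, hu₁eq, rfl⟩

/-- If the honest image of depth `k` is empty, so is every deeper one. [claim: Mochizuki2012, status: disputed] -/
theorem nonarchIterImage_add_eq_empty_of_eq_empty (logv : PadicLogs F) (v : HeightOneSpectrum (𝓞 F)) {k : ℕ}
    (hk : nonarchIterImage logv v k = ∅) (n : ℕ) : nonarchIterImage logv v (k + n) = ∅ := by
  induction n with
  | zero => simpa using hk
  | succ n ih =>
    rw [← add_assoc]
    ext z
    simp only [mem_empty_iff_false, iff_false]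
    rintro ⟨u, hu, -⟩
    rw [ih] at hu
    exact hu

/-! ## 2. CASE (a) transported: `e(v|p_v) = p_v`, `f(v|p_v) = 1`, `x^{p_v} = p_v (1 − x)` ⇒ depth `3` empty -/

/-- **At a finite place `v` with `p_v` odd, `e(v|p_v) = p_v`, `f(v|p_v) = 1`, whose completion contains `x`
with `x^{p_v} = p_v·(1 − x)`, the honest depth-`3` nonarchimedean (Ind3) iterate image for the ANALYTIC
logarithms is EMPTY**: in the rescaled completion (`e = p_v`, `f = 1` by abc-iut-S7's
`absRamificationIdx_rescaledCompletion` / `residueDegree_rescaledCompletion`) abc-iut-w5-d138's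
`DepthThree.norm_unitLog_unitLog_lt_one` (CASE (a): `xᵖ/p + x = 1`) forbids a unit `u₀` with `log_v u₀`,
`log_v(log_v u₀)` both units. [claim: Mochizuki2012, status: disputed] -/
theorem nonarchIterImage_analyticLogv_three_eq_empty_of_pow_eq (v : HeightOneSpectrum (𝓞 F))
    (hp2 : residueChar F v ≠ 2) (he : v.asIdeal.ramificationIdx ℤ = residueChar F v)
    (hf : v.asIdeal.inertiaDeg ℤ = 1) (x : v.adicCompletion F)
    (hx : x ^ residueChar F v = (residueChar F v : v.adicCompletion F) * (1 - x)) :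
    nonarchIterImage (analyticLogv F) v 3 = ∅ := by
  haveI : Fact (residueChar F v).Prime := ⟨residueChar_prime F v⟩
  have heK : absRamificationIdx (residueChar F v)
      (RescaledCompletion F (residueChar F v) v (natCast_residueChar_mem F v)) = residueChar F v := by
    rw [absRamificationIdx_rescaledCompletion, he]
  have hfK : residueDegree (residueChar F v)
      (RescaledCompletion F (residueChar F v) v (natCast_residueChar_mem F v)) = 1 := by
    rw [residueDegree_rescaledCompletion, hf]
  have hπ : (RescaledCompletion.of F (residueChar F v) v (natCast_residueChar_mem F v) x) ^ residueChar F v =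
      (residueChar F v : RescaledCompletion F (residueChar F v) v (natCast_residueChar_mem F v)) *
        (1 - RescaledCompletion.of F (residueChar F v) v (natCast_residueChar_mem F v) x) := by
    rw [← map_pow, hx, map_mul, map_sub, map_one, map_natCast]
  obtain ⟨hnorm, ha⟩ := DepthThree.caseA_of_pow_eq hπ
  have hgap := Literature.IUT.LogThetaLattice.DepthThree.gap_of_absRamificationIdx_eq (residueChar F v) heK hnorm
  have hfrob := Literature.IUT.LogThetaLattice.DepthThree.frob_of_residueDegree_eq
    (K := RescaledCompletion F (residueChar F v) v (natCast_residueChar_mem F v)) (residueChar F v) hfK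
  ext z
  simp only [mem_empty_iff_false, iff_false]
  intro hz
  obtain ⟨u₀, u₁, u₂, h₀, h₁, -⟩ := exists_units_of_mem_nonarchIterImage_three (analyticLogv F) v hz
  -- transport the chain `u₀ ↦ u₁ ↦ u₂` to the rescaled completion
  have n0 : ‖RescaledCompletion.of F (residueChar F v) v (natCast_residueChar_mem F v)
      ((u₀ : ↥(integers v)) : Carrier (.inr v : Place F))‖ = 1 :=
    norm_of_coe_unit_adicCompletionIntegers F (residueChar F v) v (natCast_residueChar_mem F v) u₀
  have l0 : unitLog (RescaledCompletion.of F (residueChar F v) v (natCast_residueChar_mem F v)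
      ((u₀ : ↥(integers v)) : Carrier (.inr v : Place F))) =
      RescaledCompletion.of F (residueChar F v) v (natCast_residueChar_mem F v)
        ((u₁ : ↥(integers v)) : Carrier (.inr v : Place F)) := by
    have h := congrArg (RescaledCompletion.of F (residueChar F v) v (natCast_residueChar_mem F v)) h₀
    rw [analyticLogv_apply, RingEquiv.apply_symm_apply] at h
    exact h
  have l1 : unitLog (RescaledCompletion.of F (residueChar F v) v (natCast_residueChar_mem F v)
      ((u₁ : ↥(integers v)) : Carrier (.inr v : Place F))) =
      RescaledCompletion.of F (residueChar F v) v (natCast_residueChar_mem F v)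
        ((u₂ : ↥(integers v)) : Carrier (.inr v : Place F)) := by
    have h := congrArg (RescaledCompletion.of F (residueChar F v) v (natCast_residueChar_mem F v)) h₁
    rw [analyticLogv_apply, RingEquiv.apply_symm_apply] at h
    exact h
  have n1 : ‖unitLog (RescaledCompletion.of F (residueChar F v) v (natCast_residueChar_mem F v)
      ((u₀ : ↥(integers v)) : Carrier (.inr v : Place F)))‖ = 1 := by
    rw [l0]
    exact norm_of_coe_unit_adicCompletionIntegers F (residueChar F v) v (natCast_residueChar_mem F v) u₁
  have n2 : ‖unitLog (unitLog (RescaledCompletion.of F (residueChar F v) v (natCast_residueChar_mem F v)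
      ((u₀ : ↥(integers v)) : Carrier (.inr v : Place F))))‖ = 1 := by
    rw [l0, l1]
    exact norm_of_coe_unit_adicCompletionIntegers F (residueChar F v) v (natCast_residueChar_mem F v) u₂
  have hlt := DepthThree.norm_unitLog_unitLog_lt_one hp2 hnorm hgap hfrob ha n0 n1
  rw [n2] at hlt
  exact lt_irrefl _ hlt

/-- … hence EVERY honest image of depth `m′ ≥ 3` at such a place is empty. [claim: Mochizuki2012, status: disputed] -/
theorem nonarchIterImage_analyticLogv_add_three_eq_empty_of_pow_eq (v : HeightOneSpectrum (𝓞 F))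
    (hp2 : residueChar F v ≠ 2) (he : v.asIdeal.ramificationIdx ℤ = residueChar F v)
    (hf : v.asIdeal.inertiaDeg ℤ = 1) (x : v.adicCompletion F)
    (hx : x ^ residueChar F v = (residueChar F v : v.adicCompletion F) * (1 - x)) (n : ℕ) :
    nonarchIterImage (analyticLogv F) v (3 + n) = ∅ :=
  nonarchIterImage_add_eq_empty_of_eq_empty (analyticLogv F) v
    (nonarchIterImage_analyticLogv_three_eq_empty_of_pow_eq v hp2 he hf x hx) n

/-- … while the depth-`2` image there is INHABITED (`p_v ∣ e(v|p_v) = p_v`, abc-iut-w5-d017 p433144): depth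
EXACTLY `2`. [claim: Mochizuki2012, status: disputed] -/
theorem nonarchIterImage_analyticLogv_two_nonempty_and_three_eq_empty (v : HeightOneSpectrum (𝓞 F))
    (hp2 : residueChar F v ≠ 2) (he : v.asIdeal.ramificationIdx ℤ = residueChar F v)
    (hf : v.asIdeal.inertiaDeg ℤ = 1) (x : v.adicCompletion F)
    (hx : x ^ residueChar F v = (residueChar F v : v.adicCompletion F) * (1 - x)) :
    (nonarchIterImage (analyticLogv F) v 2).Nonempty ∧ nonarchIterImage (analyticLogv F) v 3 = ∅ :=
  ⟨nonarchIterImage_analyticLogv_two_nonempty_of_dvd v hp2 (by rw [he]),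
    nonarchIterImage_analyticLogv_three_eq_empty_of_pow_eq v hp2 he hf x hx⟩

/-! ## 3. CASE (b) transported: a `p`-th root of `p` in `F_v` ⇒ EVERY depth inhabited -/

/-- At a finite place `v` over the odd prime `p_v` whose completion contains `x` with `x^{p_v} = p_v`: for
every `n` there is a unit `u ∈ O_v^×` whose rescaled image is the `n`-th iterated logarithm of `1 + x` (a unit,
abc-iut-w5-d138 gen 4 `norm_iterate_unitLog_one_add_pi`) and whose analytic logarithm lies in the honest
image of depth `n + 1`. [claim: Mochizuki2012, status: disputed] -/
theorem exists_unit_iterate_mem_nonarchIterImage_of_pow_prime (v : HeightOneSpectrum (𝓞 F))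
    (hp2 : residueChar F v ≠ 2) (x : v.adicCompletion F)
    (hx : x ^ residueChar F v = (residueChar F v : v.adicCompletion F)) (n : ℕ) :
    ∃ u : (↥(integers v))ˣ,
      RescaledCompletion.of F (residueChar F v) v (natCast_residueChar_mem F v)
          ((u : ↥(integers v)) : Carrier (.inr v : Place F)) =
        (haveI : Fact (residueChar F v).Prime := ⟨residueChar_prime F v⟩
         unitLog^[n] (RescaledCompletion.of F (residueChar F v) v (natCast_residueChar_mem F v) (1 + x))) ∧
      analyticLogv F v (Additive.ofMul u) ∈ nonarchIterImage (analyticLogv F) v (n + 1) := by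
  haveI : Fact (residueChar F v).Prime := ⟨residueChar_prime F v⟩
  have hπ : (RescaledCompletion.of F (residueChar F v) v (natCast_residueChar_mem F v) x) ^ residueChar F v =
      (residueChar F v : RescaledCompletion F (residueChar F v) v (natCast_residueChar_mem F v)) := by
    rw [← map_pow, hx, map_natCast]
  have hiter : ∀ k, ‖unitLog^[k]
      (RescaledCompletion.of F (residueChar F v) v (natCast_residueChar_mem F v) (1 + x))‖ = 1 := fun k => by
    rw [map_add, map_one]; exact norm_iterate_unitLog_one_add_pi hp2 hπ k
  induction n with
  | zero =>
    obtain ⟨u, hu⟩ := exists_unit_coe_eq_of_norm_rescaled_eq_one v (residueChar F v)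
      (natCast_residueChar_mem F v) (1 + x) (by simpa using hiter 0)
    refine ⟨u, ?_, ?_⟩
    · show RescaledCompletion.of F (residueChar F v) v (natCast_residueChar_mem F v)
          (((u : ↥(v.adicCompletionIntegers F))) : v.adicCompletion F) = _
      rw [hu, Function.iterate_zero_apply]
    · rw [nonarchIterImage_one_eq_range]
      exact ⟨u, rfl⟩
  | succ n ih =>
    obtain ⟨u, hu, hmem⟩ := ih
    -- `z := log_v u` has rescaled image `unitLog^[n+1] (1 + x)`, a unit
    have hz : RescaledCompletion.of F (residueChar F v) v (natCast_residueChar_mem F v)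
        (analyticLogv F v (Additive.ofMul u)) =
        unitLog^[n + 1] (RescaledCompletion.of F (residueChar F v) v (natCast_residueChar_mem F v) (1 + x)) := by
      rw [analyticLogv_apply, RingEquiv.apply_symm_apply, Function.iterate_succ_apply']
      exact congrArg unitLog hu
    obtain ⟨w, hw⟩ := exists_unit_coe_eq_of_norm_rescaled_eq_one v (residueChar F v)
      (natCast_residueChar_mem F v) (analyticLogv F v (Additive.ofMul u)) (by rw [hz]; exact hiter (n + 1))
    refine ⟨w, ?_, ?_⟩
    · show RescaledCompletion.of F (residueChar F v) v (natCast_residueChar_mem F v)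
          (((w : ↥(v.adicCompletionIntegers F))) : v.adicCompletion F) = _
      rw [hw, hz]
    · refine ⟨w, ?_, rfl⟩
      show (((w : ↥(v.adicCompletionIntegers F))) : v.adicCompletion F) ∈ nonarchIterImage (analyticLogv F) v (n + 1)
      rw [hw]
      exact hmem

/-- **At a finite place `v` with `p_v` odd whose completion contains a `p_v`-th root of `p_v`, EVERY honest
nonarchimedean (Ind3) iterate image for the analytic logarithms is INHABITED** — the all-depth form of
abc-iut-w5-d172's depth-`2` statement p425849 (`…WildOddPrime`). [claim: Mochizuki2012, status: disputed] -/
theorem nonarchIterImage_analyticLogv_nonempty_of_pow_prime (v : HeightOneSpectrum (𝓞 F))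
    (hp2 : residueChar F v ≠ 2) (x : v.adicCompletion F)
    (hx : x ^ residueChar F v = (residueChar F v : v.adicCompletion F)) (n : ℕ) :
    (nonarchIterImage (analyticLogv F) v n).Nonempty := by
  cases n with
  | zero => exact ⟨1, one_mem_unitsSet_inr v⟩
  | succ n =>
    obtain ⟨u, -, hmem⟩ := exists_unit_iterate_mem_nonarchIterImage_of_pow_prime v hp2 x hx n
    exact ⟨_, hmem⟩

/-! ## 4. Computing `e(v|p) = p`, `f(v|p) = 1` from `[F : ℚ] ≤ p` and an element of norm `p^{−1/p}` -/

/-- **`[F : ℚ] ≤ p` and `‖x‖' ^ p = p⁻¹` for some `x ∈ F_v` (rescaled norm) ⇒ `e(v|p) = p`, `f(v|p) = 1`**: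
`[F_v : ℚ_p] = n_v ≤ Σ_{w ∣ p} n_w = [F : ℚ] ≤ p` (abc-iut-c312-3/S7 fundamental identity), then
abc-iut-w5-d138's local `absRamificationIdx_eq_and_residueDegree_eq_of_finrank_le` and abc-iut-S7's
dictionary `e(F_v) = e(v|p)`, `f(F_v) = f(v|p)`. [cite: NeukirchANT1999, Ch. II Prop. (6.8)] -/
theorem ramificationIdx_eq_and_inertiaDeg_eq_of_finrank_le {p : ℕ} (hp : p.Prime)
    (hF : Module.finrank ℚ F ≤ p) (v : HeightOneSpectrum (𝓞 F)) (hv : ((p : ℕ) : 𝓞 F) ∈ v.asIdeal)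
    (x : v.adicCompletion F) (hx : ‖RescaledCompletion.of F p v hv x‖ ^ p = (p : ℝ)⁻¹) :
    v.asIdeal.ramificationIdx ℤ = p ∧ v.asIdeal.inertiaDeg ℤ = 1 := by
  haveI : Fact p.Prime := ⟨hp⟩
  have hmem : v ∈ placesOver F p := (mem_placesOver_iff_residueChar v).mpr (residueChar_eq_of_prime_natCast_mem v hp hv)
  have hloc : localDeg F v ≤ Module.finrank ℚ F := by
    rw [← sum_localDeg F p]
    exact Finset.single_le_sum (fun w _ => Nat.zero_le (localDeg F w)) hmem
  have h2 : Module.finrank ℚ_[p] (RescaledCompletion F p v hv) = localDeg F v :=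
    (RescaledCompletion.localDeg_eq_finrank F p v hv).symm
  have hfin : Module.finrank ℚ_[p] (RescaledCompletion F p v hv) ≤ p := by
    rw [h2]
    exact hloc.trans hF
  obtain ⟨he, hf⟩ :=
    Literature.IUT.LogThetaLattice.DepthThree.absRamificationIdx_eq_and_residueDegree_eq_of_finrank_le p hfin hx
  rw [absRamificationIdx_rescaledCompletion] at he
  rw [residueDegree_rescaledCompletion] at hf
  exact ⟨he, hf⟩

/-! ## 5. Both cases occur over number fields, at `(p_v, e, f) = (p, p, 1)`, for every odd `p` -/

/-- **A number field of degree `≤ p` with a root of `Xᵖ + mX − n`** (`m, n ∈ ℕ`): `ℚ[X]/(g)` for an irreducible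
factor `g` of `Xᵖ + mX − n`. [folklore] -/
theorem exists_numberField_root {p : ℕ} (hp : p.Prime) (m n : ℕ) :
    ∃ (F : Type) (_ : Field F) (_ : NumberField F),
      Module.finrank ℚ F ≤ p ∧ ∃ α : F, α ^ p + (m : F) * α = (n : F) := by
  let f : ℚ[X] := X ^ p + (C (m : ℚ) * X - C (n : ℚ))
  have hXp : degree ((X : ℚ[X]) ^ p) = p := degree_X_pow p
  have hdeg : degree (C (m : ℚ) * X - C (n : ℚ)) < (p : WithBot ℕ) := by
    refine (degree_sub_le _ _).trans_lt (max_lt ?_ ?_)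
    · exact (degree_C_mul_X_le (m : ℚ)).trans_lt (by exact_mod_cast hp.one_lt)
    · exact degree_C_le.trans_lt (by exact_mod_cast hp.pos)
  have hfdeg : f.degree = p := by
    show degree (X ^ p + (C (m : ℚ) * X - C (n : ℚ))) = p
    rw [degree_add_eq_left_of_degree_lt (by rwa [hXp]), hXp]
  have hf : f.natDegree = p := natDegree_eq_of_degree_eq_some hfdeg
  have hfne : f.natDegree ≠ 0 := by rw [hf]; exact hp.ne_zero
  have hf0 : f ≠ 0 := fun h => hfne (by rw [h, natDegree_zero])
  haveI : Fact (Irreducible f.factor) := ⟨irreducible_factor f⟩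
  have hg0 : f.factor ≠ 0 := (irreducible_factor f).ne_zero
  haveI : Module.Finite ℚ (AdjoinRoot f.factor) := (AdjoinRoot.powerBasis hg0).finite
  haveI : CharZero (AdjoinRoot f.factor) :=
    charZero_of_injective_algebraMap (algebraMap ℚ (AdjoinRoot f.factor)).injective
  haveI : NumberField (AdjoinRoot f.factor) := NumberField.mk
  have hdvd : f.factor ∣ f := factor_dvd_of_natDegree_ne_zero hfne
  refine ⟨AdjoinRoot f.factor, inferInstance, inferInstance, ?_, AdjoinRoot.root f.factor, ?_⟩
  · rw [(AdjoinRoot.powerBasis hg0).finrank, AdjoinRoot.powerBasis_dim, ← hf]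
    exact natDegree_le_of_dvd hdvd hf0
  · have halg : algebraMap ℚ (AdjoinRoot f.factor) = AdjoinRoot.of f.factor := Subsingleton.elim _ _
    have hroot : aeval (AdjoinRoot.root f.factor) f.factor = 0 := by
      rw [aeval_def, halg]
      exact AdjoinRoot.eval₂_root f.factor
    have h0 : aeval (AdjoinRoot.root f.factor) f = 0 := aeval_eq_zero_of_dvd_aeval_eq_zero hdvd hroot
    have h1 : aeval (AdjoinRoot.root f.factor) f =
        AdjoinRoot.root f.factor ^ p + ((m : AdjoinRoot f.factor) * AdjoinRoot.root f.factor - n) := by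
      simp [f, map_natCast]
    rw [h1] at h0
    linear_combination h0

/-- **CASE (a) OCCURS over number fields: for every odd prime `p` there are a number field `F` and a finite
place `v` with `p_v = p`, `e(v|p) = p`, `f(v|p) = 1`, at which the honest depth-`2` (Ind3) image for the analytic
logarithms is INHABITED and the depth-`3` image is EMPTY** (`F = ℚ[X]/(g)`, `g ∣ Xᵖ + pX − p`, any place over
`p`). [claim: Mochizuki2012, status: disputed] -/
theorem exists_numberField_nonarchIterImage_three_eq_empty {p : ℕ} (hp : p.Prime) (hp2 : p ≠ 2) :
    ∃ (F : Type) (_ : Field F) (_ : NumberField F) (v : HeightOneSpectrum (𝓞 F)),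
      residueChar F v = p ∧ v.asIdeal.ramificationIdx ℤ = p ∧ v.asIdeal.inertiaDeg ℤ = 1 ∧
        (nonarchIterImage (analyticLogv F) v 2).Nonempty ∧ nonarchIterImage (analyticLogv F) v 3 = ∅ := by
  haveI : Fact p.Prime := ⟨hp⟩
  obtain ⟨F, _, _, hF, α, hα⟩ := exists_numberField_root hp p p
  obtain ⟨v, hv⟩ := exists_heightOneSpectrum_natCast_mem' (F := F) hp
  have hres : residueChar F v = p := residueChar_eq_of_prime_natCast_mem v hp hv
  -- the root in the completion
  set x : v.adicCompletion F := algebraMap F (v.adicCompletion F) α with hxdef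
  have hx : x ^ p = (p : v.adicCompletion F) * (1 - x) := by
    have h := congrArg (algebraMap F (v.adicCompletion F)) hα
    rw [map_add, map_pow, map_mul, map_natCast] at h
    rw [hxdef]
    linear_combination h
  -- `e = p`, `f = 1` from the rescaled norm of `x`
  have hnorm : ‖RescaledCompletion.of F p v hv x‖ ^ p = (p : ℝ)⁻¹ := by
    have hπ : (RescaledCompletion.of F p v hv x) ^ p =
        (p : RescaledCompletion F p v hv) * (1 - RescaledCompletion.of F p v hv x) := by
      rw [← map_pow, hx, map_mul, map_sub, map_one, map_natCast]
    exact (DepthThree.caseA_of_pow_eq hπ).1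
  obtain ⟨he, hf⟩ := ramificationIdx_eq_and_inertiaDeg_eq_of_finrank_le hp hF v hv x hnorm
  have hx' : x ^ residueChar F v = (residueChar F v : v.adicCompletion F) * (1 - x) := by rw [hres]; exact hx
  obtain ⟨h2, h3⟩ := nonarchIterImage_analyticLogv_two_nonempty_and_three_eq_empty v (hres ▸ hp2)
    (by rw [he, hres]) hf x hx'
  exact ⟨F, inferInstance, inferInstance, v, hres, he, hf, h2, h3⟩

/-- **CASE (b) OCCURS over number fields at the SAME invariants: for every odd prime `p` there are a number
field `F` and a finite place `v` with `p_v = p`, `e(v|p) = p`, `f(v|p) = 1`, at which EVERY honest (Ind3) image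
for the analytic logarithms is INHABITED** (`F = ℚ[X]/(g)`, `g ∣ Xᵖ − p`). [claim: Mochizuki2012, status: disputed] -/
theorem exists_numberField_forall_nonarchIterImage_nonempty {p : ℕ} (hp : p.Prime) (hp2 : p ≠ 2) :
    ∃ (F : Type) (_ : Field F) (_ : NumberField F) (v : HeightOneSpectrum (𝓞 F)),
      residueChar F v = p ∧ v.asIdeal.ramificationIdx ℤ = p ∧ v.asIdeal.inertiaDeg ℤ = 1 ∧
        ∀ n : ℕ, (nonarchIterImage (analyticLogv F) v n).Nonempty := by
  haveI : Fact p.Prime := ⟨hp⟩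
  obtain ⟨F, _, _, hF, α, hα⟩ := exists_numberField_root hp 0 p
  obtain ⟨v, hv⟩ := exists_heightOneSpectrum_natCast_mem' (F := F) hp
  have hres : residueChar F v = p := residueChar_eq_of_prime_natCast_mem v hp hv
  set x : v.adicCompletion F := algebraMap F (v.adicCompletion F) α with hxdef
  have hx : x ^ p = (p : v.adicCompletion F) := by
    have h := congrArg (algebraMap F (v.adicCompletion F)) hα
    rw [Nat.cast_zero, zero_mul, add_zero, map_pow, map_natCast] at h
    rw [hxdef]
    exact h
  have hnorm : ‖RescaledCompletion.of F p v hv x‖ ^ p = (p : ℝ)⁻¹ := by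
    have hπ : (RescaledCompletion.of F p v hv x) ^ p = (p : RescaledCompletion F p v hv) := by
      rw [← map_pow, hx, map_natCast]
    exact WildPrime.norm_pi_pow hπ
  obtain ⟨he, hf⟩ := ramificationIdx_eq_and_inertiaDeg_eq_of_finrank_le hp hF v hv x hnorm
  have hx' : x ^ residueChar F v = (residueChar F v : v.adicCompletion F) := by rw [hres]; exact hx
  exact ⟨F, inferInstance, inferInstance, v, hres, he, hf,
    nonarchIterImage_analyticLogv_nonempty_of_pow_prime v (hres ▸ hp2) x hx'⟩

end Summit.ABC.IUTFork.Thm311.Real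

end
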